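import Summits.ResolutionOfSingularities.ResolutionOfSingularities.Theses.Descent
import Literature.AlgebraicGeometry.Resolution.CompletedPullbackRegular
import Mathlib.RingTheory.Derivation.Basic
import Mathlib.RingTheory.Etale.Kaehler
import Mathlib.RingTheory.Kaehler.Polynomial
import Mathlib.RingTheory.Localization.FractionRing
import Mathlib.Algebra.MvPolynomial.PDeriv
import Mathlib.Data.Fintype.EquivFin
import Mathlib.FieldTheory.RatFunc.Basic
import HarnessLib

/-!
# The p-rank conjunct split of `DescentPerfectToAll` — crux workfile, lens 4 («uniformity / ultraproduct
# conditional bridge»), seat res-B-lens-4 gen 7 (stmt-ResolutionOfSingularities-0549)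

[OURS · CANDIDATE] counted 0; nothing here proves resolution in char p. CENSUS-GRADE typing, not a line:
no `DescentPerfectToAll_of` with registered stubs is claimed (memo `UNIFORMITY-CENSUS-lens4-g7.md` §B says why).

## What is typed
For a prime `p` write `PerfectRes p` for the crux's hypothesis (resolution of every reduced separated
finite-type scheme over every PERFECT field of characteristic `p`). The crux `DescentPerfectToAll` is, prime by
prime, `PerfectRes p → ResolutionInChar p`.

* `BInfty p` — **the infinite-p-rank half**: `PerfectRes p →` resolution over every field `K` of characteristic
  `p` of infinite p-rank (`InfinitePRank K`, copied verbatim from gen 6's `PGeneric.InfinitePRank`: derivations of `K` separate points from any finite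
  set, i.e. `[K : K^p] = ∞`).
* `PurelyTranscendentalDescentAll p` — **purely transcendental descent over ALL fields**:
  `Res(X ×_K Spec K(t)) ⇒ Res(X)` for every field `K` of characteristic `p` (gen 6 typed and paper-proved the
  infinite-p-rank case `PGeneric.PurelyTranscendentalDescent` by p-generic specialisation; the CONTENT of the
  all-fields version is the finite-p-rank case, where p-generic points do not exist and the model family of
  gen 6 §3 has singular fibres at every separable point).
* `Recomposition` — the paper-proved implication `BInfty p → PurelyTranscendentalDescentAll p → PerfectRes p →
  ResolutionInChar p` (memo §B: for `K` of finite p-rank put `L = K(t₁, t₂, …)`, which has infinite p-rank;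
  `BInfty` resolves `X_L`; the resolution is defined and — by faithfully flat descent of regularity, EGA IV 6.5.1 —
  regular over some `K(t₁, …, t_m)`; `m` applications of purely transcendental descent, legitimate because
  `PurelyTranscendentalDescentAll` is typed over ALL fields so no p-rank bookkeeping is needed on the way down —
  the finite-p-rank remark only locates the content — reach `K`).
  It is recorded as a `Prop` (the spreading-out / limit formalisation is prover-sized), and the bookkeeping
  `descentPerfectToAll_of_recomposition` shows how it would recompose the crux.
* PROVED here (no `sorry`): (i) input (1) of the recomposition — the coordinate derivations `∂/∂t_i` on the
  total fraction ring `K(t_σ) = Frac K[t_σ]` (`coordDerivFrac`, built from the universal derivation through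
  `Ω[K(t)⁄K] ≅ K(t) ⊗ Ω[K[t]⁄K]`, localisations being formally étale, and the `dt_i`-coordinate of Mathlib's
  `KaehlerDifferential.mvPolynomialBasis`; `coordDerivFrac_algebraMap : ∂_i (a) = pderiv i a`, quotient rule via
  `IsLocalization.mk'_spec`) and hence `infinitePRank_fractionRing_mvPolynomial : InfinitePRank K(t_σ)` for
  infinite `σ` (any commutative ring `K`); (ii) pure logic: the crux implies both halves —
  `bInfty_of_descentPerfectToAll`, `purelyTranscendentalDescentAll_of_resolutionInChar`,
  `pieces_of_descentPerfectToAll` — so, GIVEN `Recomposition`, the split is a CONJUNCT split: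
  `DescentPerfectToAll ⟺ ∀ p prime, BInfty p ∧ (PerfectRes p → PurelyTranscendentalDescentAll p)`.

## Why it is census, not a line (memo §B.4)
`BInfty` still contains Mac Lane's residual field of infinite p-rank (tree:
`Theorems.macLaneField_frobenius_rank_unbounded` with `…ResidualWitnessMacLane`), so it is crux-grade on that
instance; `PurelyTranscendentalDescentAll` in finite p-rank is the generic-fibre form of the inseparability
obstruction (regular ≠ smooth over `K(t)`), open, with gen 6's Q2⁻ showing fibrewise specialisation fails there.
Two hard halves, no why-easier for either: by the census standard (STRATEGY-CENSUS-s1 §D3) this is recorded, not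
registered.
-/

set_option linter.dupNamespace false

open AlgebraicGeometry CategoryTheory
open Literature.AlgebraicGeometry.Resolution

namespace Summit.ResolutionOfSingularities.ResolutionOfSingularities.Cruxes.DescentPerfectToAll.UniformityG7

/-- `InfinitePRank K` — VERBATIM copy of gen 6's `PGeneric.InfinitePRank` (crux workfile
`PGenericSpecialisationLens4g6.lean`, not importable as a module on the farm): for every finite `s ⊆ K` some
derivation of `K` kills `s` and takes the value `1` somewhere; for a field of characteristic `p` this says
`[K : K^p] = ∞`. [cite: Matsumura1987, Thm. 26.5] -/
def InfinitePRank (K : Type*) [CommRing K] : Prop :=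
  ∀ s : Finset K, ∃ (b : K) (δ : Derivation ℤ K K), (∀ x ∈ s, δ x = 0) ∧ δ b = 1

/-! ## §1 Coordinate derivations on `K(t_σ)` and `InfinitePRank K(t_ℕ)` (input (1) of `Recomposition`) -/

section FractionFieldDerivation

open KaehlerDifferential TensorProduct MvPolynomial

variable (K : Type) [CommRing K] (σ : Type)

/-- `K(t_σ)`: the total fraction ring of the polynomial ring `K[t_σ]`. -/
abbrev Frac : Type := FractionRing (MvPolynomial σ K)

/-- Localisations are formally étale (Mathlib `Algebra.FormallyEtale.of_isLocalization`). -/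
theorem formallyEtale_frac : Algebra.FormallyEtale (MvPolynomial σ K) (Frac K σ) :=
  Algebra.FormallyEtale.of_isLocalization (M := nonZeroDivisors (MvPolynomial σ K))

/-- `Ω[K(t)⁄K] ≅ K(t) ⊗_{K[t]} Ω[K[t]⁄K]`. -/
noncomputable def kaehlerFracEquiv :
    Frac K σ ⊗[MvPolynomial σ K] Ω[MvPolynomial σ K⁄K] ≃ₗ[Frac K σ] Ω[Frac K σ⁄K] :=
  haveI := formallyEtale_frac K σ
  tensorKaehlerEquivOfFormallyEtale K (MvPolynomial σ K) (Frac K σ)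

theorem kaehlerFracEquiv_symm_D_algebraMap (s : MvPolynomial σ K) :
    (kaehlerFracEquiv K σ).symm (D K (Frac K σ) (algebraMap _ (Frac K σ) s)) = 1 ⊗ₜ D K (MvPolynomial σ K) s := by
  haveI := formallyEtale_frac K σ
  exact tensorKaehlerEquivOfFormallyEtale_symm_D_algebraMap K (MvPolynomial σ K) (Frac K σ) s

/-- The `dt_i`-coordinate `K(t) ⊗ Ω[K[t]⁄K] → K(t)`. -/
noncomputable def evalCoord (i : σ) :
    Frac K σ ⊗[MvPolynomial σ K] Ω[MvPolynomial σ K⁄K] →ₗ[Frac K σ] Frac K σ :=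
  (AlgebraTensorModule.rid (MvPolynomial σ K) (Frac K σ) (Frac K σ)).toLinearMap ∘ₗ
    ((mvPolynomialBasis K σ).coord i).baseChange (Frac K σ)

theorem evalCoord_one_tmul (i : σ) (ω : Ω[MvPolynomial σ K⁄K]) :
    evalCoord K σ i (1 ⊗ₜ ω) = algebraMap _ (Frac K σ) ((mvPolynomialBasis K σ).repr ω i) := by
  simp only [evalCoord, LinearMap.coe_comp, Function.comp_apply, LinearEquiv.coe_coe, LinearMap.baseChange_tmul,
    AlgebraTensorModule.rid_tmul, Algebra.smul_def, mul_one]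
  rfl

/-- The coordinate derivation `∂/∂t_i` on `K(t_σ)`. -/
noncomputable def coordDerivFrac (i : σ) : Derivation K (Frac K σ) (Frac K σ) :=
  (evalCoord K σ i ∘ₗ (kaehlerFracEquiv K σ).symm.toLinearMap).compDer (D K (Frac K σ))

theorem coordDerivFrac_apply (i : σ) (x : Frac K σ) :
    coordDerivFrac K σ i x = evalCoord K σ i ((kaehlerFracEquiv K σ).symm (D K (Frac K σ) x)) := rfl

theorem coordDerivFrac_algebraMap (i : σ) (s : MvPolynomial σ K) :
    coordDerivFrac K σ i (algebraMap _ (Frac K σ) s) = algebraMap _ (Frac K σ) (pderiv i s) := by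
  rw [coordDerivFrac_apply, kaehlerFracEquiv_symm_D_algebraMap, evalCoord_one_tmul, mvPolynomialBasis_repr_apply]

theorem coordDerivFrac_X_self (i : σ) :
    coordDerivFrac K σ i (algebraMap _ (Frac K σ) (X i : MvPolynomial σ K)) = 1 := by
  rw [coordDerivFrac_algebraMap, pderiv_X_self, map_one]

theorem coordDerivFrac_mk'_eq_zero (i : σ) (a : MvPolynomial σ K) (b : nonZeroDivisors (MvPolynomial σ K))
    (ha : i ∉ a.vars) (hb : i ∉ (b : MvPolynomial σ K).vars) :
    coordDerivFrac K σ i (IsLocalization.mk' (Frac K σ) a b) = 0 := by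
  have hδa : coordDerivFrac K σ i (algebraMap _ (Frac K σ) a) = 0 := by
    rw [coordDerivFrac_algebraMap, pderiv_eq_zero_of_notMem_vars ha, map_zero]
  have hδb : coordDerivFrac K σ i (algebraMap _ (Frac K σ) (b : MvPolynomial σ K)) = 0 := by
    rw [coordDerivFrac_algebraMap, pderiv_eq_zero_of_notMem_vars hb, map_zero]
  have h := congrArg (coordDerivFrac K σ i) (IsLocalization.mk'_spec (Frac K σ) a b)
  rw [Derivation.leibniz, hδa, hδb, smul_zero, zero_add, smul_eq_mul] at h
  exact ((IsLocalization.map_units (Frac K σ) b).mul_right_eq_zero).mp h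

/-- `K(t_σ)` for infinite `σ` has infinite p-rank in the derivation sense of `InfinitePRank`: for every finite set
`s` of fractions there is an index `i` occurring in none of their chosen numerators/denominators, and `∂/∂t_i` kills
`s` while `∂t_i/∂t_i = 1`. -/
theorem exists_derivation_fractionRing_mvPolynomial [Infinite σ] (s : Finset (Frac K σ)) :
    ∃ (b : Frac K σ) (δ : Derivation ℤ (Frac K σ) (Frac K σ)), (∀ x ∈ s, δ x = 0) ∧ δ b = 1 := by
  classical
  have hsurj : ∀ z : Frac K σ, ∃ q : MvPolynomial σ K × nonZeroDivisors (MvPolynomial σ K),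
      IsLocalization.mk' (Frac K σ) q.1 q.2 = z :=
    fun z => IsLocalization.mk'_surjective (nonZeroDivisors (MvPolynomial σ K)) z
  choose q hq using hsurj
  let V : Finset σ := s.sup fun x => (q x).1.vars ∪ ((q x).2 : MvPolynomial σ K).vars
  obtain ⟨i, hi⟩ := Infinite.exists_notMem_finset V
  refine ⟨algebraMap _ (Frac K σ) (X i : MvPolynomial σ K), (coordDerivFrac K σ i).restrictScalars ℤ, ?_, ?_⟩
  · intro x hx
    have hsub : (q x).1.vars ∪ ((q x).2 : MvPolynomial σ K).vars ≤ V :=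
      Finset.le_sup (f := fun x => (q x).1.vars ∪ ((q x).2 : MvPolynomial σ K).vars) hx
    have ha : i ∉ (q x).1.vars := fun h => hi (hsub (Finset.mem_union_left _ h))
    have hb : i ∉ ((q x).2 : MvPolynomial σ K).vars := fun h => hi (hsub (Finset.mem_union_right _ h))
    rw [Derivation.restrictScalars_apply, ← hq x]
    exact coordDerivFrac_mk'_eq_zero K σ i (q x).1 (q x).2 ha hb
  · rw [Derivation.restrictScalars_apply, coordDerivFrac_X_self]


/-- **`K(t_σ)` has infinite p-rank** (in gen 6's derivation sense) for every commutative ring `K` and infinite `σ`;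
in particular `L = K(t_ℕ)` in the recomposition B.2. [folklore] -/
theorem infinitePRank_fractionRing_mvPolynomial [Infinite σ] : InfinitePRank (Frac K σ) := by
  intro s
  -- `InfinitePRank` reads the `ℤ`-algebra structure `Ring.toIntAlgebra`; the localisation carries
  -- `OreLocalization.instAlgebra`; they agree because ring maps out of `ℤ` are unique.
  have hAlg : (OreLocalization.instAlgebra : Algebra ℤ (Frac K σ)) = Ring.toIntAlgebra (Frac K σ) :=
    Algebra.algebra_ext _ _ fun r => by rw [eq_intCast, eq_intCast]
  have key := exists_derivation_fractionRing_mvPolynomial K σ s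
  rw [hAlg] at key
  exact key

end FractionFieldDerivation

/-! ## §2 The split -/

/-- `PerfectRes p`: the hypothesis of the crux at the prime `p` — every reduced separated scheme of finite type
over every perfect field of characteristic `p` has a resolution (verbatim the antecedent of
`Theses.Descent.DescentPerfectToAll`). [our conjecture] -/
def PerfectRes (p : ℕ) : Prop :=
  ∀ (k : Type) [Field k] [CharP k p] [PerfectField k] (X : Scheme.{0}) (f : X ⟶ Spec (.of k)),
    IsSeparated f → LocallyOfFiniteType f → QuasiCompact f → IsReduced X → Scheme.HasResolution X

/-- **B_∞(p)**, the infinite-p-rank half of the crux: `PerfectRes p` implies resolution over every field of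
characteristic `p` of infinite p-rank (`InfinitePRank`, gen 6). Contains Mac Lane's residual witness, hence not
known to be easier than the crux. [our conjecture] -/
def BInfty (p : ℕ) : Prop :=
  PerfectRes p → ∀ (K : Type) [Field K] [CharP K p], InfinitePRank K →
    ∀ (X : Scheme.{0}) (f : X ⟶ Spec (.of K)), IsSeparated f → LocallyOfFiniteType f → QuasiCompact f →
      IsReduced X → Scheme.HasResolution X

/-- **Purely transcendental descent over all fields of characteristic `p`**: a resolution of
`X ×_K Spec K(t)` (`K(t) = RatFunc K`) yields one of `X`. The infinite-p-rank case is gen 6's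
`PGeneric.PurelyTranscendentalDescent` (paper-proved by p-generic specialisation); the finite-p-rank case is
open and carries the inseparability obstruction in generic-fibre form. [our conjecture] -/
def PurelyTranscendentalDescentAll (p : ℕ) : Prop :=
  ∀ (K : Type) [Field K] [CharP K p] (X : Scheme.{0}) (f : X ⟶ Spec (.of K)),
    IsSeparated f → LocallyOfFiniteType f → QuasiCompact f → IsReduced X →
      Scheme.HasResolution (Limits.pullback f (specOfAlgebra K (RatFunc K))) → Scheme.HasResolution X

/-- **Recomposition** (paper proof: memo `UNIFORMITY-CENSUS-lens4-g7.md` §B.2; inputs: `[K(t) : K(t)^p] =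
p·[K : K^p]`, `InfinitePRank K(t_ℕ)`, EGA IV₃ 8.8.2/8.10.5 spreading out of a proper birational morphism over the
directed union `K(t_ℕ) = ⋃_m K(t₁…t_m)`, EGA IV₂ 6.5.1 descent of regularity along the faithfully flat
`Y_m ⊗ K(t_ℕ) → Y_m`, induction on `m`). Typed as a `Prop`; its formalisation is prover-sized. [folklore] -/
def Recomposition : Prop :=
  ∀ p : ℕ, p.Prime → BInfty p → PurelyTranscendentalDescentAll p → PerfectRes p → ResolutionInChar.{0} p

/-- The crux implies its infinite-p-rank half (restriction). [folklore] -/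
theorem bInfty_of_descentPerfectToAll (h : Theses.Descent.DescentPerfectToAll) (p : ℕ) (hp : p.Prime) :
    BInfty p := by
  intro hperf K _ _ _ X f hs hl hq hr
  exact h p hp hperf K X f hs hl hq hr

/-- Resolution in characteristic `p` implies purely transcendental descent outright (the conclusion holds
unconditionally). [folklore] -/
theorem purelyTranscendentalDescentAll_of_resolutionInChar (p : ℕ) (h : ResolutionInChar.{0} p) :
    PurelyTranscendentalDescentAll p := by
  intro K _ _ X f hs hl hq hr _
  exact h K X f hs hl hq hr

/-- Conjunct reading: the crux implies BOTH pieces of the split, prime by prime. [folklore] -/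
theorem pieces_of_descentPerfectToAll (h : Theses.Descent.DescentPerfectToAll) (p : ℕ) (hp : p.Prime) :
    BInfty p ∧ (PerfectRes p → PurelyTranscendentalDescentAll p) :=
  ⟨bInfty_of_descentPerfectToAll h p hp,
    fun hperf => purelyTranscendentalDescentAll_of_resolutionInChar p (h p hp hperf)⟩

/-- Bookkeeping: given the (paper-proved, here hypothesised) `Recomposition`, the two halves recompose the crux.
[folklore] -/
theorem descentPerfectToAll_of_recomposition (hR : Recomposition) (hB : ∀ p : ℕ, p.Prime → BInfty p)
    (hP : ∀ p : ℕ, p.Prime → PurelyTranscendentalDescentAll p) : Theses.Descent.DescentPerfectToAll :=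
  fun p hp hperf => hR p hp (hB p hp) (hP p hp) hperf

/-- Hence, modulo `Recomposition`, the split is an EQUIVALENCE (conjunct split of the crux). [folklore] -/
theorem descentPerfectToAll_iff_pieces (hR : Recomposition) :
    Theses.Descent.DescentPerfectToAll ↔
      ∀ p : ℕ, p.Prime → BInfty p ∧ (PerfectRes p → PurelyTranscendentalDescentAll p) := by
  constructor
  · exact fun h p hp => pieces_of_descentPerfectToAll h p hp
  · intro h p hp hperf
    exact hR p hp (h p hp).1 (fun K _ _ X f hs hl hq hr hres => (h p hp).2 hperf K X f hs hl hq hr hres) hperf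

end Summit.ResolutionOfSingularities.ResolutionOfSingularities.Cruxes.DescentPerfectToAll.UniformityG7
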